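import Mathlib.Algebra.Ring.Basic
import Mathlib.Data.Fintype.Basic
import Mathlib.Data.Fintype.Prod
import Mathlib.Data.ZMod.Defs
import Mathlib.Tactic.Ring
import HarnessLib

/-!
# The rank-`3` algebra `R[t]/(t³ - r t² - q t - p)` on triples, computably

Topic `NumberTheory/NumberFields`, sub-namespace `CubicRing` (the object). For a commutative ring
`R` and `p q r : R`, `CubicRing R p q r` is the type of triples `⟨x, y, z⟩` ("`x + y t + z t²`")
with the multiplication of `R[t]/(t³ - r t² - q t - p)` written out through the reduction rules
`t³ = p + q t + r t²`, `t⁴ = r p + (p + r q) t + (q + r²) t²`. It is a commutative ring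
(`CubicRing.instCommRing`; the axioms are polynomial identities, closed by `ring`), has decidable
equality and is finite when `R` is, and its structure maps are COMPUTABLE, so that statements
quantified over `CubicRing (ZMod 4) p q r` (`= 𝓞_K/4𝓞_K` for a monogenic cubic field in which
`2` is inert) are decided by the kernel. `CubicRing.gen_cubic`: the generator `t = ⟨0, 1, 0⟩`
satisfies `t³ = p + q t + r t²`, so that `𝓞_K = ℤ[θ] → CubicRing (ZMod n) p q r`, `θ ↦ t`,
exists by the universal property of `ℤ[X]/(f) ≅ 𝓞_K` (`Cubic.exists_ringHom_of_root`).

This is plumbing for the explicit `2`-descents of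
`Literature/Barriers/BirchSwinnertonDyer/RankNotSumOfLocalInvariantsF3Cubic*.lean`; no number
theory is proved here. (Mathlib's `AdjoinRoot` over `ZMod n` is the same ring but is not
computable, being a quotient of `Polynomial`.)

## References

* D. A. Marcus, *Number Fields*, 2nd ed. (2018), Ch. 2 (orders `ℤ[θ]` and their quotients).
  [folklore]
-/

namespace Literature.NumberTheory.NumberFields

/-- Triples `⟨x, y, z⟩ = x + y t + z t²` over `R`: the carrier of `R[t]/(t³ - r t² - q t - p)`.
The parameters `p q r` only enter the multiplication. [folklore] -/
@[ext]
structure CubicRing (R : Type*) (p q r : R) where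
  /-- constant coefficient -/
  c0 : R
  /-- coefficient of `t` -/
  c1 : R
  /-- coefficient of `t²` -/
  c2 : R
  deriving DecidableEq

namespace CubicRing

variable {R : Type*} [CommRing R] {p q r : R}

/-- Triples as an iterated product (for transferring instances). [folklore] -/
def equivProd (R : Type*) (p q r : R) : CubicRing R p q r ≃ R × R × R where
  toFun u := (u.c0, u.c1, u.c2)
  invFun v := ⟨v.1, v.2.1, v.2.2⟩
  left_inv _ := rfl
  right_inv _ := rfl

/-- Finitely many triples over a finite ring (computably, for `decide`). [folklore] -/
instance [Fintype R] : Fintype (CubicRing R p q r) := Fintype.ofEquiv _ (equivProd R p q r).symm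

/-- Addition is componentwise. [folklore] -/
instance : Add (CubicRing R p q r) := ⟨fun u v => ⟨u.c0 + v.c0, u.c1 + v.c1, u.c2 + v.c2⟩⟩
/-- Zero. [folklore] -/
instance : Zero (CubicRing R p q r) := ⟨⟨0, 0, 0⟩⟩
/-- Negation is componentwise. [folklore] -/
instance : Neg (CubicRing R p q r) := ⟨fun u => ⟨-u.c0, -u.c1, -u.c2⟩⟩
/-- Subtraction is componentwise. [folklore] -/
instance : Sub (CubicRing R p q r) := ⟨fun u v => ⟨u.c0 - v.c0, u.c1 - v.c1, u.c2 - v.c2⟩⟩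
/-- One is `⟨1, 0, 0⟩`. [folklore] -/
instance : One (CubicRing R p q r) := ⟨⟨1, 0, 0⟩⟩

/-- **Multiplication** of `x + y t + z t²` and `x' + y' t + z' t²` modulo `t³ = p + q t + r t²`.
[folklore] -/
instance : Mul (CubicRing R p q r) :=
  ⟨fun u v =>
    let d0 := u.c0 * v.c0
    let d1 := u.c0 * v.c1 + u.c1 * v.c0
    let d2 := u.c0 * v.c2 + u.c1 * v.c1 + u.c2 * v.c0
    let d3 := u.c1 * v.c2 + u.c2 * v.c1
    let d4 := u.c2 * v.c2
    ⟨d0 + p * d3 + r * p * d4, d1 + q * d3 + (p + r * q) * d4, d2 + r * d3 + (q + r ^ 2) * d4⟩⟩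

/-- Natural number literals `⟨n, 0, 0⟩`. [folklore] -/
instance : NatCast (CubicRing R p q r) := ⟨fun n => ⟨n, 0, 0⟩⟩
/-- Integer literals `⟨n, 0, 0⟩`. [folklore] -/
instance : IntCast (CubicRing R p q r) := ⟨fun n => ⟨n, 0, 0⟩⟩

/-- The constant-coefficient of `add`. [folklore] -/
@[simp] theorem add_c0 (u v : CubicRing R p q r) : (u + v).c0 = u.c0 + v.c0 := rfl
/-- The `t`-coefficient of `add`. [folklore] -/
@[simp] theorem add_c1 (u v : CubicRing R p q r) : (u + v).c1 = u.c1 + v.c1 := rfl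
/-- The `t²`-coefficient of `add`. [folklore] -/
@[simp] theorem add_c2 (u v : CubicRing R p q r) : (u + v).c2 = u.c2 + v.c2 := rfl
/-- The constant-coefficient of `zero`. [folklore] -/
@[simp] theorem zero_c0 : (0 : CubicRing R p q r).c0 = 0 := rfl
/-- The `t`-coefficient of `zero`. [folklore] -/
@[simp] theorem zero_c1 : (0 : CubicRing R p q r).c1 = 0 := rfl
/-- The `t²`-coefficient of `zero`. [folklore] -/
@[simp] theorem zero_c2 : (0 : CubicRing R p q r).c2 = 0 := rfl
/-- The constant-coefficient of `neg`. [folklore] -/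
@[simp] theorem neg_c0 (u : CubicRing R p q r) : (-u).c0 = -u.c0 := rfl
/-- The `t`-coefficient of `neg`. [folklore] -/
@[simp] theorem neg_c1 (u : CubicRing R p q r) : (-u).c1 = -u.c1 := rfl
/-- The `t²`-coefficient of `neg`. [folklore] -/
@[simp] theorem neg_c2 (u : CubicRing R p q r) : (-u).c2 = -u.c2 := rfl
/-- The constant-coefficient of `sub`. [folklore] -/
@[simp] theorem sub_c0 (u v : CubicRing R p q r) : (u - v).c0 = u.c0 - v.c0 := rfl
/-- The `t`-coefficient of `sub`. [folklore] -/
@[simp] theorem sub_c1 (u v : CubicRing R p q r) : (u - v).c1 = u.c1 - v.c1 := rfl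
/-- The `t²`-coefficient of `sub`. [folklore] -/
@[simp] theorem sub_c2 (u v : CubicRing R p q r) : (u - v).c2 = u.c2 - v.c2 := rfl
/-- The constant-coefficient of `one`. [folklore] -/
@[simp] theorem one_c0 : (1 : CubicRing R p q r).c0 = 1 := rfl
/-- The `t`-coefficient of `one`. [folklore] -/
@[simp] theorem one_c1 : (1 : CubicRing R p q r).c1 = 0 := rfl
/-- The `t²`-coefficient of `one`. [folklore] -/
@[simp] theorem one_c2 : (1 : CubicRing R p q r).c2 = 0 := rfl
/-- The constant-coefficient of `natCast`. [folklore] -/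
@[simp] theorem natCast_c0 (n : ℕ) : (n : CubicRing R p q r).c0 = n := rfl
/-- The `t`-coefficient of `natCast`. [folklore] -/
@[simp] theorem natCast_c1 (n : ℕ) : (n : CubicRing R p q r).c1 = 0 := rfl
/-- The `t²`-coefficient of `natCast`. [folklore] -/
@[simp] theorem natCast_c2 (n : ℕ) : (n : CubicRing R p q r).c2 = 0 := rfl
/-- The constant-coefficient of `intCast`. [folklore] -/
@[simp] theorem intCast_c0 (n : ℤ) : (n : CubicRing R p q r).c0 = n := rfl
/-- The `t`-coefficient of `intCast`. [folklore] -/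
@[simp] theorem intCast_c1 (n : ℤ) : (n : CubicRing R p q r).c1 = 0 := rfl
/-- The `t²`-coefficient of `intCast`. [folklore] -/
@[simp] theorem intCast_c2 (n : ℤ) : (n : CubicRing R p q r).c2 = 0 := rfl

/-- The constant-coefficient of `mul`. [folklore] -/
theorem mul_c0 (u v : CubicRing R p q r) : (u * v).c0 =
    u.c0 * v.c0 + p * (u.c1 * v.c2 + u.c2 * v.c1) + r * p * (u.c2 * v.c2) := rfl
/-- The `t`-coefficient of `mul`. [folklore] -/
theorem mul_c1 (u v : CubicRing R p q r) : (u * v).c1 =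
    u.c0 * v.c1 + u.c1 * v.c0 + q * (u.c1 * v.c2 + u.c2 * v.c1) + (p + r * q) * (u.c2 * v.c2) :=
  rfl
/-- The `t²`-coefficient of `mul`. [folklore] -/
theorem mul_c2 (u v : CubicRing R p q r) : (u * v).c2 =
    u.c0 * v.c2 + u.c1 * v.c1 + u.c2 * v.c0 + r * (u.c1 * v.c2 + u.c2 * v.c1) +
      (q + r ^ 2) * (u.c2 * v.c2) := rfl

/-- **`R[t]/(t³ - r t² - q t - p)` is a commutative ring** (all axioms are polynomial
identities in the coordinates). [folklore] -/
instance instCommRing : CommRing (CubicRing R p q r) where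
  add_assoc u v w := by ext <;> simp [add_assoc]
  zero_add u := by ext <;> simp
  add_zero u := by ext <;> simp
  add_comm u v := by ext <;> simp [add_comm]
  neg_add_cancel u := by ext <;> simp
  sub_eq_add_neg u v := by ext <;> simp [sub_eq_add_neg]
  nsmul := nsmulRec
  zsmul := zsmulRec
  left_distrib u v w := by
    ext <;> simp only [mul_c0, mul_c1, mul_c2, add_c0, add_c1, add_c2] <;> ring
  right_distrib u v w := by
    ext <;> simp only [mul_c0, mul_c1, mul_c2, add_c0, add_c1, add_c2] <;> ring
  zero_mul u := by ext <;> simp [mul_c0, mul_c1, mul_c2]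
  mul_zero u := by ext <;> simp [mul_c0, mul_c1, mul_c2]
  mul_assoc u v w := by ext <;> simp only [mul_c0, mul_c1, mul_c2] <;> ring
  one_mul u := by ext <;> simp [mul_c0, mul_c1, mul_c2]
  mul_one u := by ext <;> simp [mul_c0, mul_c1, mul_c2]
  mul_comm u v := by ext <;> simp only [mul_c0, mul_c1, mul_c2] <;> ring
  npow := npowRec
  natCast_zero := by ext <;> simp
  natCast_succ n := by ext <;> simp
  intCast_ofNat n := by ext <;> simp
  intCast_negSucc n := by ext <;> simp [Int.negSucc_eq]

/-- The generator `t = ⟨0, 1, 0⟩`. [folklore] -/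
def gen (R : Type*) [CommRing R] (p q r : R) : CubicRing R p q r := ⟨0, 1, 0⟩

/-- `t² = ⟨0, 0, 1⟩`. [folklore] -/
theorem gen_sq : gen R p q r ^ 2 = ⟨0, 0, 1⟩ := by
  ext <;> simp [pow_succ, pow_zero, gen, mul_c0, mul_c1, mul_c2]

/-- **The defining relation** `t³ = p + q t + r t²`, i.e. `t³ - r t² - q t - p = 0`. [folklore] -/
theorem gen_cubic : gen R p q r ^ 3 = ⟨p, q, r⟩ := by
  rw [pow_succ, gen_sq]
  ext <;> simp [gen, mul_c0, mul_c1, mul_c2]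

/-- The "constants" map `x ↦ ⟨x, 0, 0⟩` as a ring homomorphism `R →+* R[t]/(…)`.
[folklore] -/
def C : R →+* CubicRing R p q r where
  toFun x := ⟨x, 0, 0⟩
  map_one' := rfl
  map_mul' x y := by ext <;> simp [mul_c0, mul_c1, mul_c2]
  map_zero' := rfl
  map_add' x y := by ext <;> simp

/-- The constant-coefficient of `C`. [folklore] -/
@[simp] theorem C_c0 (x : R) : (C x : CubicRing R p q r).c0 = x := rfl
/-- The `t`-coefficient of `C`. [folklore] -/
@[simp] theorem C_c1 (x : R) : (C x : CubicRing R p q r).c1 = 0 := rfl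
/-- The `t²`-coefficient of `C`. [folklore] -/
@[simp] theorem C_c2 (x : R) : (C x : CubicRing R p q r).c2 = 0 := rfl

/-- The coordinates of `x + y t + z t²` are `(x, y, z)`. [folklore] -/
theorem eq_lin (u : CubicRing R p q r) :
    u = C u.c0 + C u.c1 * gen R p q r + C u.c2 * gen R p q r ^ 2 := by
  rw [gen_sq]
  ext <;> simp [gen, mul_c0, mul_c1, mul_c2]

/-- The defining relation in monic integer form: `t³ + a t² + b t + c = 0` in
`R[t]/(t³ + a t² + b t + c)`, i.e. for `(p, q, r) = (-c, -b, -a)`; this is the hypothesis of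
`Cubic.exists_ringHom_of_root` for the target `CubicRing R (-c) (-b) (-a)`. [folklore] -/
theorem gen_root (a b c : ℤ) :
    gen R (-(c : R)) (-(b : R)) (-(a : R)) ^ 3 +
      (a : CubicRing R (-(c : R)) (-(b : R)) (-(a : R))) *
        gen R (-(c : R)) (-(b : R)) (-(a : R)) ^ 2 +
      (b : CubicRing R (-(c : R)) (-(b : R)) (-(a : R))) * gen R (-(c : R)) (-(b : R)) (-(a : R)) +
      (c : CubicRing R (-(c : R)) (-(b : R)) (-(a : R))) = 0 := by
  rw [gen_cubic, gen_sq]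
  ext <;> simp [gen, mul_c0, mul_c1, mul_c2]

end CubicRing

end Literature.NumberTheory.NumberFields
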